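import Summits.CriticalPhenomena.PercolationContinuityZ3.Theorems.PercNearOneGluingNoHeavyLowerTailSahiOneStepUniformThreshold
import Summits.CriticalPhenomena.PercolationContinuityZ3.Theorems.PercNearOneGluingNoHeavyLowerTailSahiOneStepFreeBlockReduce
import Summits.CriticalPhenomena.PercolationContinuityZ3.Theorems.PercNearOneGluingNoHeavyLowerTailSahiOneStepFreeOdd
import Summits.CriticalPhenomena.PercolationContinuityZ3.Theorems.PercNearOneGluingNoHeavyLowerTailSahiOneStepFibreThresholdAll
import Summits.CriticalPhenomena.PercolationContinuityZ3.Theorems.PercNearOneGluingNoHeavyLowerTailSahiOneStepFreeStep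
import HarnessLib

/-!
# `(2′)` FOR EVERY HAMMING THRESHOLD WITH A FREE BLOCK OF ARBITRARY DENSITIES

Support file (prover prim-ineq-prove-3 gen 53; `--supports stmt-CriticalPhenomena-4575`; memo
`run/shared/lean/prim/prim-ineq-prove-3/PROOF-G53-FREE-BLOCK.md`).  No definitions, no named facts, no sorries, no `native_decide`.

**THEOREM (`osN_threshold_nonneg_of_const_freeBlock`).**  Let the density vector be a constant `P ∈ (0,1)` on the block `F` and ARBITRARY in
`(0,1)` on a disjoint FREE BLOCK `E`.  Then for every threshold `t` and all increasing `F`-determined events `A, B`: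
`0 ≤ n(Th_t(F ∪ E); A, B)`, i.e. `Cov(1_A,1_B) ≥ μ(N_{F∪E} < t)·Cov(1_A,1_B ∣ N_{F∪E} < t)`; and (`sahiE3_threshold_nonneg_of_const_freeBlock`, with
the `(3′)` half `osMp_threshold_nonneg_all` of gen 17) Kahn C5 / Sahi C₃: `0 ≤ E₃(1_{N_{F∪E} ≥ t}, 1_A, 1_B)`.
Gen 21's `osN_threshold_nonneg_of_const` is `E = ∅`, gen 52's `osN_threshold_nonneg_of_const_free` is `#E = 1`.  Equivalently (memo §1): on the
UNIFORM cube `2^F`, collapsing the FUZZY Hamming ball with ANY level profile `φ_k = P(N_E ≤ t−1−k)` — these are exactly the non-increasing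
LOG-CONCAVE profiles realised by free coordinates — keeps increasing events positively correlated: `Cov_u(A,B) ≥ E_u[φ]·Cov_{u_φ}(A,B)`.

Proof (memo §2–§4): gen 21's induction on `F` (opposite compressions inside `F`, where the density is constant; pivot `e` = the new coordinate,
dominant for `A` and dominated for `B`), with MONO-B and `H`-generation replaced by the COSTLY-REGION REDUCTION of `…FreeBlockReduce`:
the partner `B` is replaced by `B₂ = ↑(B♯ ∖ G)` (`G = A ∩ {N_{insert e F} ≥ g}` the region where `B`-points cost, `B♯` the hull of `B` over `G`),
which does not increase `n` and produces a partner NOT DEPENDING ON `e` (`exists_free_reduct`); then the cross term of the pivot identity is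
`−κ·U_A·U_{B₂} ≥ 0` by MONO-A (`drift_nonneg_of_dominant`, any density; `e` dominates the free coordinates because `A` does not depend on them) and
ball monotonicity (`drift_nonpos_of_free`).
-/

noncomputable section

namespace Summit.CriticalPhenomena.PercolationContinuityZ3.Theorems

namespace SahiOneStep

open MeasureTheory Finset
open Literature.Probability.Percolation (DeterminedBy determinedBy_iff)
open Literature.Probability.LatticeModels (prodBernoulli prodBernoulli_harris sahiE3)
open Literature.Probability.Percolation.DecisionTree (ind)
open SahiE3Sections (determinedBy_section_insert determinedBy_section_sdiff)
open scoped Classical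

variable {ι : Type*} [Fintype ι]

/-- **THE `(2′)` HALF FOR EVERY HAMMING THRESHOLD, CONSTANT DENSITY PLUS A FREE BLOCK OF ARBITRARY DENSITIES** (memo Theorem 2): density
`P ∈ (0,1)` on `F`, any densities in `(0,1)` on the disjoint block `E`, slot `Th_t(F ∪ E)`, all increasing `F`-determined `A, B`:
`0 ≤ n(Th_t(F ∪ E); A, B)`. [this work] -/
theorem osN_threshold_nonneg_of_const_freeBlock (p : ι → unitInterval) {P : ℝ} (hP0 : 0 < P) (hP1 : P < 1) (E : Finset ι)
    (hpE : ∀ i ∈ E, 0 < (p i : ℝ) ∧ (p i : ℝ) < 1) (F : Finset ι) (hFE : Disjoint F E)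
    (hpF : ∀ i ∈ F, (p i : ℝ) = P) (t : ℕ) {A B : Set (Set ι)} (hA : IsUpperSet A) (hB : IsUpperSet B)
    (hAF : DeterminedBy A (↑F : Set ι)) (hBF : DeterminedBy B (↑F : Set ι)) :
    0 ≤ osN p {ω : Set ι | t ≤ ((F ∪ E).filter (· ∈ ω)).card} (ind A) (ind B) := by
  induction F using Finset.induction_on generalizing t A B with
  | empty =>
    have hagree : ∀ ω : Set ι, (∅ : Set ι) ∩ (↑(∅ : Finset ι) : Set ι) = ω ∩ ↑(∅ : Finset ι) := fun ω => by simp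
    by_cases h : (∅ : Set ι) ∈ A
    · have hAu : A = Set.univ := Set.eq_univ_of_forall fun ω => ((determinedBy_iff _ _).1 hAF ∅ ω (hagree ω)).1 h
      rw [hAu]; exact (osN_ind_ind_univ_left p _ _).symm.le
    · have hAe : A = ∅ := Set.eq_empty_of_forall_notMem fun ω hω => h (((determinedBy_iff _ _).1 hAF ∅ ω (hagree ω)).2 hω)
      rw [hAe]; exact (osN_ind_ind_empty_left p _ _).symm.le
  | insert e F heF ih =>
    have hFE' : Disjoint F E := Finset.disjoint_of_subset_left (Finset.subset_insert e F) hFE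
    have heE : e ∉ E := Finset.disjoint_left.1 hFE (Finset.mem_insert_self e F)
    have hpF' : ∀ i ∈ F, (p i : ℝ) = P := fun i hi => hpF i (Finset.mem_insert_of_mem hi)
    -- the slot block is `insert e G`, `G = F ∪ E`
    rw [Finset.insert_union]
    set G : Finset ι := F ∪ E with hGdef
    have heG : e ∉ G := by
      intro h
      rcases Finset.mem_union.1 h with h | h
      · exact heF h
      · exact heE h
    have hFG' : F ⊆ G := Finset.subset_union_left
    have hp01 : ∀ i ∈ G, 0 < (p i : ℝ) ∧ (p i : ℝ) < 1 := by
      intro i hi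
      rcases Finset.mem_union.1 hi with hi | hi
      · rw [hpF' i hi]; exact ⟨hP0, hP1⟩
      · exact hpE i hi
    have hFG : (↑(insert e F) : Set ι) ⊆ ↑(insert e G) := by
      intro i hi
      simp only [Finset.coe_insert, Set.mem_insert_iff, Finset.mem_coe, hGdef, Finset.mem_union] at hi ⊢
      tauto
    cases t with
    | zero => rw [threshold_zero, osN_ind_ind_univ]
    | succ t =>
      by_cases ht : t ≤ G.card
      swap
      · rw [threshold_eq_empty_of_card_lt (insert e G) (by rw [Finset.card_insert_of_notMem heG]; omega), osN_ind_ind_empty]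
      rcases Nat.eq_zero_or_pos t with rfl | htpos
      · exact osN_thresholdOne_nonneg p (insert e G) hA hB (hAF.mono hFG) (hBF.mono hFG)
      -- `1 ≤ t ≤ #G`: inner induction on the compression potential
      have heG' : e ∈ insert e G := Finset.mem_insert_self e G
      have heEF : e ∈ insert e F := Finset.mem_insert_self e F
      have hcoe : (↑(insert e F) : Set ι) \ {e} = ↑F := by
        ext i
        simp only [Set.mem_sdiff, Finset.coe_insert, Set.mem_insert_iff, Finset.mem_coe, Set.mem_singleton_iff]
        constructor
        · rintro ⟨h | h, hne⟩
          · exact absurd h hne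
          · exact h
        · intro h
          exact ⟨Or.inr h, fun hie => heF (hie ▸ h)⟩
      suffices key : ∀ (m : ℕ) (A B : Set (Set ι)), IsUpperSet A → IsUpperSet B →
          DeterminedBy A (↑(insert e F) : Set ι) → DeterminedBy B (↑(insert e F) : Set ι) →
          #((insert e F).powerset.filter fun S : Finset ι => (((↑S : Set ι) ∈ A) ∧ e ∉ S)) +
            #((insert e F).powerset.filter fun S : Finset ι => (((↑S : Set ι) ∈ B) ∧ e ∈ S)) = m →
          0 ≤ osN p {ω : Set ι | t + 1 ≤ ((insert e G).filter (· ∈ ω)).card} (ind A) (ind B) from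
        key _ A B hA hB hAF hBF rfl
      intro m
      induction m using Nat.strong_induction_on with
      | _ m ihm =>
      intro A B hA hB hAF hBF hm
      by_cases hdom : (∀ j ∈ F, ∀ ω ∈ A, e ∉ ω → j ∈ ω → (ω \ {j}) ∪ {e} ∈ A) ∧
          (∀ j ∈ F, ∀ ω ∈ B, e ∈ ω → j ∉ ω → (ω \ {e}) ∪ {j} ∈ B)
      · -- dominated pair: replace `B` by its costly-region reduction `B₂` (which is `e`-free) and apply the cross-form step lemma
        obtain ⟨hdomA, hdomB⟩ := hdom
        obtain ⟨B₂, hB₂up, hB₂F, hB₂free, hle⟩ := exists_free_reduct p heG hFG' t hA hB hAF hBF hdomA hdomB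
        refine le_trans ?_ hle
        refine osN_ind_ind_nonneg_of_cross p _ _ _ e ?_ ?_ ?_ ?_ ?_ ?_ ?_ ?_
        · rw [section_insert_threshold heG]
          exact ih hFE' hpF' t (isUpperSet_section_insert hA e) (isUpperSet_section_insert hB₂up e)
            (hcoe ▸ determinedBy_section_insert hAF e) (hcoe ▸ determinedBy_section_insert hB₂F e)
        · rw [section_sdiff_threshold heG]
          exact ih hFE' hpF' (t + 1) (isUpperSet_section_sdiff hA e) (isUpperSet_section_sdiff hB₂up e)
            (hcoe ▸ determinedBy_section_sdiff hAF e) (hcoe ▸ determinedBy_section_sdiff hB₂F e)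
        · rw [section_insert_threshold heG]; exact real_threshold_lt_one p G hp01 t htpos
        · rw [section_sdiff_threshold heG]; exact real_threshold_lt_one p G hp01 (t + 1) (by omega)
        · exact measureReal_mono (section_sdiff_subset_section_insert hA e)
        · exact measureReal_mono (section_sdiff_subset_section_insert hB₂up e)
        · refine drift_nonneg_of_dominant p heG ht hp01 hA (hAF.mono hFG) ?_
          intro ω hω heω j hj hjω
          rcases Finset.mem_union.1 hj with hjF | hjE
          · exact hdomA j hjF ω hω heω hjω
          · -- `j ∈ E`: `A` does not depend on `j`, so `e` dominates `j` for free
            have hjK : j ∉ (↑(insert e F) : Set ι) := by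
              rw [Finset.coe_insert, Set.mem_insert_iff, Finset.mem_coe]
              rintro (rfl | hjF)
              · exact heE hjE
              · exact Finset.disjoint_left.1 hFE' hjF hjE
            have hfree : ω \ {j} ∈ A := by
              refine mem_of_union_mem_of_determinedBy hAF hjK ?_
              have hωeq : ω \ {j} ∪ {j} = ω := by
                rw [Set.sdiff_union_self, Set.union_eq_left.2 (Set.singleton_subset_iff.2 hjω)]
              rw [hωeq]; exact hω
            exact hA Set.subset_union_left hfree
        · exact drift_nonpos_of_free p heG t hB₂up (hB₂F.mono hFG) hB₂free
      · -- a trade fails: compress along that pair of coordinates; the potential drops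
        have hex : ∃ j ∈ F, (∃ ω ∈ A, e ∉ ω ∧ j ∈ ω ∧ (ω \ {j}) ∪ {e} ∉ A) ∨ (∃ ω ∈ B, e ∈ ω ∧ j ∉ ω ∧ (ω \ {e}) ∪ {j} ∉ B) := by
          rw [not_and_or] at hdom
          rcases hdom with h | h
          · push Not at h
            obtain ⟨j, hj, ω, hω, heω, hjω, hno⟩ := h
            exact ⟨j, hj, Or.inl ⟨ω, hω, heω, hjω, hno⟩⟩
          · push Not at h
            obtain ⟨j, hj, ω, hω, heω, hjω, hno⟩ := h
            exact ⟨j, hj, Or.inr ⟨ω, hω, heω, hjω, hno⟩⟩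
        obtain ⟨j, hjF, hwit⟩ := hex
        have hej : e ≠ j := fun h => heF (h ▸ hjF)
        have hjG : j ∈ insert e F := Finset.mem_insert_of_mem hjF
        have hpej : p e = p j := Subtype.ext (by rw [hpF e heEF, hpF j hjG])
        obtain ⟨CA, hCAdef⟩ : ∃ CA : Set (Set ι), CA = {ω : Set ι | (ω ∈ A ∧ {x : ι | Equiv.swap e j x ∈ ω} ∈ A) ∨
          (e ∈ ω ∧ j ∉ ω ∧ (ω ∈ A ∨ {x : ι | Equiv.swap e j x ∈ ω} ∈ A))} := ⟨_, rfl⟩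
        obtain ⟨CB, hCBdef⟩ : ∃ CB : Set (Set ι), CB = {ω : Set ι | (ω ∈ B ∧ {x : ι | Equiv.swap e j x ∈ ω} ∈ B) ∨
          (j ∈ ω ∧ e ∉ ω ∧ (ω ∈ B ∨ {x : ι | Equiv.swap e j x ∈ ω} ∈ B))} := ⟨_, rfl⟩
        have hCA : ∀ ω : Set ι, ω ∈ CA ↔ (ω ∈ A ∧ {x : ι | Equiv.swap e j x ∈ ω} ∈ A) ∨
            (e ∈ ω ∧ j ∉ ω ∧ (ω ∈ A ∨ {x : ι | Equiv.swap e j x ∈ ω} ∈ A)) := fun ω => by rw [hCAdef]; exact Iff.rfl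
        have hCB : ∀ ω : Set ι, ω ∈ CB ↔ (ω ∈ B ∧ {x : ι | Equiv.swap e j x ∈ ω} ∈ B) ∨
            (j ∈ ω ∧ e ∉ ω ∧ (ω ∈ B ∨ {x : ι | Equiv.swap e j x ∈ ω} ∈ B)) := fun ω => by rw [hCBdef]; exact Iff.rfl
        have hCB' : ∀ ω : Set ι, ω ∈ CB ↔ (ω ∈ B ∧ {x : ι | Equiv.swap j e x ∈ ω} ∈ B) ∨
            (j ∈ ω ∧ e ∉ ω ∧ (ω ∈ B ∨ {x : ι | Equiv.swap j e x ∈ ω} ∈ B)) := by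
          intro ω; rw [Equiv.swap_comm j e]; exact hCB ω
        have hCAup : IsUpperSet CA := isUpperSet_of_compress hej hA hCA
        have hCBup : IsUpperSet CB := isUpperSet_of_compress hej.symm hB hCB'
        have hCAG : DeterminedBy CA (↑(insert e F) : Set ι) := determinedBy_of_compress heEF hjG hAF hCA
        have hCBG : DeterminedBy CB (↑(insert e F) : Set ι) := determinedBy_of_compress hjG heEF hBF hCB'
        have hsubA := filter_pat_compress_subset (G := insert e F) hCA
        have hsubB := filter_pat_compress_subset' (G := insert e F) hCB
        have hlt : #((insert e F).powerset.filter fun S : Finset ι => (((↑S : Set ι) ∈ CA) ∧ e ∉ S)) +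
            #((insert e F).powerset.filter fun S : Finset ι => (((↑S : Set ι) ∈ CB) ∧ e ∈ S)) < m := by
          rcases hwit with ⟨ω, hωA, heω, hjω, hno⟩ | ⟨ω, hωB, heω, hjω, hno⟩
          · have hS₀e : e ∉ ((↑((insert e F).filter (· ∈ ω)) : Set ι)) := fun h => by
              rw [Finset.mem_coe, Finset.mem_filter] at h; exact heω h.2
            have hS₀j : j ∈ ((↑((insert e F).filter (· ∈ ω)) : Set ι)) := by
              rw [Finset.mem_coe, Finset.mem_filter]; exact ⟨hjG, hjω⟩
            have hS₀A : (insert e F).filter (· ∈ ω) ∈ (insert e F).powerset.filter (fun S : Finset ι => (((↑S : Set ι) ∈ A) ∧ e ∉ S)) := by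
              rw [Finset.mem_filter]
              exact ⟨Finset.mem_powerset.2 (Finset.filter_subset _ _), (coe_filter_mem_iff hAF ω).2 hωA,
                fun h => heω (Finset.mem_filter.1 h).2⟩
            have hS₀C : (insert e F).filter (· ∈ ω) ∉ (insert e F).powerset.filter (fun S : Finset ι => (((↑S : Set ι) ∈ CA) ∧ e ∉ S)) := by
              intro h
              rw [Finset.mem_filter] at h
              rcases (hCA _).1 h.2.1 with ⟨_, hσ⟩ | ⟨he', _, _⟩
              · rw [swapSet_eq_trade hS₀e hS₀j] at hσ
                have htr := trade_inter_eq (coe_filter_inter_eq (insert e F) ω) j e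
                exact hno (((determinedBy_iff _ _).1 hAF _ _ htr).1 hσ)
              · exact hS₀e he'
            have h1 := Finset.card_lt_card ((Finset.ssubset_iff_of_subset hsubA).2 ⟨_, hS₀A, hS₀C⟩)
            have h2 := Finset.card_le_card hsubB
            omega
          · have hS₀e : e ∈ ((↑((insert e F).filter (· ∈ ω)) : Set ι)) := by
              rw [Finset.mem_coe, Finset.mem_filter]; exact ⟨heEF, heω⟩
            have hS₀j : j ∉ ((↑((insert e F).filter (· ∈ ω)) : Set ι)) := fun h => by
              rw [Finset.mem_coe, Finset.mem_filter] at h; exact hjω h.2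
            have hS₀B : (insert e F).filter (· ∈ ω) ∈ (insert e F).powerset.filter (fun S : Finset ι => (((↑S : Set ι) ∈ B) ∧ e ∈ S)) := by
              rw [Finset.mem_filter]
              exact ⟨Finset.mem_powerset.2 (Finset.filter_subset _ _), (coe_filter_mem_iff hBF ω).2 hωB,
                Finset.mem_filter.2 ⟨heEF, heω⟩⟩
            have hS₀C : (insert e F).filter (· ∈ ω) ∉ (insert e F).powerset.filter (fun S : Finset ι => (((↑S : Set ι) ∈ CB) ∧ e ∈ S)) := by
              intro h
              rw [Finset.mem_filter] at h
              rcases (hCB _).1 h.2.1 with ⟨_, hσ⟩ | ⟨_, he', _⟩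
              · rw [swapSet_eq_trade' hS₀e hS₀j] at hσ
                have htr := trade_inter_eq (coe_filter_inter_eq (insert e F) ω) e j
                exact hno (((determinedBy_iff _ _).1 hBF _ _ htr).1 hσ)
              · exact he' hS₀e
            have h1 := Finset.card_le_card hsubA
            have h2 := Finset.card_lt_card ((Finset.ssubset_iff_of_subset hsubB).2 ⟨_, hS₀B, hS₀C⟩)
            omega
        calc (0 : ℝ) ≤ osN p {ω : Set ι | t + 1 ≤ ((insert e G).filter (· ∈ ω)).card} (ind CA) (ind CB) :=
              ihm _ hlt CA CB hCAup hCBup hCAG hCBG rfl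
          _ ≤ osN p {ω : Set ι | t + 1 ≤ ((insert e G).filter (· ∈ ω)).card} (ind A) (ind B) :=
              osN_compress_le p heG' (Finset.mem_insert_of_mem (hFG' hjF)) hpej (t + 1)
                (hAF.mono hFG) (hBF.mono hFG) hCA hCB

/-- **KAHN C5 / SAHI C₃ FOR EVERY HAMMING-THRESHOLD FIRST SLOT WITH A FREE BLOCK** (memo Corollary 3).  Density constant `P ∈ (0,1)` on `F`,
arbitrary in `(0,1)` on the disjoint block `E`; for every `t` and all increasing `F`-determined `A, B`:
`0 ≤ E₃(1_{#((F∪E)∩ω) ≥ t}, 1_A, 1_B)`.  The `(3′)` half is `osMp_threshold_nonneg_all` (gen 17, every density, all pairs). [this work] -/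
theorem sahiE3_threshold_nonneg_of_const_freeBlock (p : ι → unitInterval) {P : ℝ} (hP0 : 0 < P) (hP1 : P < 1) (E : Finset ι)
    (hpE : ∀ i ∈ E, 0 < (p i : ℝ) ∧ (p i : ℝ) < 1) (F : Finset ι) (hFE : Disjoint F E)
    (hpF : ∀ i ∈ F, (p i : ℝ) = P) (t : ℕ) {A B : Set (Set ι)} (hA : IsUpperSet A) (hB : IsUpperSet B)
    (hAF : DeterminedBy A (↑F : Set ι)) (hBF : DeterminedBy B (↑F : Set ι)) :
    0 ≤ sahiE3 (prodBernoulli p) {ω : Set ι | t ≤ ((F ∪ E).filter (· ∈ ω)).card} A B := by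
  rw [← osT_ind_ind, osT_eq_osMp_add_osN]
  exact add_nonneg (osMp_threshold_nonneg_all p (F ∪ E) t hA hB)
    (osN_threshold_nonneg_of_const_freeBlock p hP0 hP1 E hpE F hFE hpF t hA hB hAF hBF)

/-- **Covariance form** (memo Theorem 2′): under the same hypotheses, with `H = Th_t(F ∪ E)`, `L = Hᶜ`:
`μ(L)·μA·μB ≤ μ(L∩A)·μ(L∩B) + μ(L)·μ(H∩A∩B)`, i.e. `Cov(1_A,1_B) ≥ μ(L)·Cov(1_A,1_B ∣ L)` — collapsing the Hamming ball of a block whose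
free part carries arbitrary densities keeps `F`-determined increasing events positively correlated. [this work] -/
theorem ball_cov_le_cov_of_const_freeBlock (p : ι → unitInterval) {P : ℝ} (hP0 : 0 < P) (hP1 : P < 1) (E : Finset ι)
    (hpE : ∀ i ∈ E, 0 < (p i : ℝ) ∧ (p i : ℝ) < 1) (F : Finset ι) (hFE : Disjoint F E)
    (hpF : ∀ i ∈ F, (p i : ℝ) = P) (t : ℕ) {A B : Set (Set ι)} (hA : IsUpperSet A) (hB : IsUpperSet B)
    (hAF : DeterminedBy A (↑F : Set ι)) (hBF : DeterminedBy B (↑F : Set ι)) :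
    (1 - (prodBernoulli p).real {ω : Set ι | t ≤ ((F ∪ E).filter (· ∈ ω)).card}) * (prodBernoulli p).real A * (prodBernoulli p).real B ≤
      ((prodBernoulli p).real A - (prodBernoulli p).real ({ω : Set ι | t ≤ ((F ∪ E).filter (· ∈ ω)).card} ∩ A)) *
        ((prodBernoulli p).real B - (prodBernoulli p).real ({ω : Set ι | t ≤ ((F ∪ E).filter (· ∈ ω)).card} ∩ B))
      + (1 - (prodBernoulli p).real {ω : Set ι | t ≤ ((F ∪ E).filter (· ∈ ω)).card}) *
          (prodBernoulli p).real ({ω : Set ι | t ≤ ((F ∪ E).filter (· ∈ ω)).card} ∩ A ∩ B) := by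
  have h := osN_threshold_nonneg_of_const_freeBlock p hP0 hP1 E hpE F hFE hpF t hA hB hAF hBF
  rw [osN_ind_ind] at h
  have e : ((prodBernoulli p).real A - (prodBernoulli p).real ({ω : Set ι | t ≤ ((F ∪ E).filter (· ∈ ω)).card} ∩ A)) *
        ((prodBernoulli p).real B - (prodBernoulli p).real ({ω : Set ι | t ≤ ((F ∪ E).filter (· ∈ ω)).card} ∩ B))
      + (1 - (prodBernoulli p).real {ω : Set ι | t ≤ ((F ∪ E).filter (· ∈ ω)).card}) *
          (prodBernoulli p).real ({ω : Set ι | t ≤ ((F ∪ E).filter (· ∈ ω)).card} ∩ A ∩ B)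
      - (1 - (prodBernoulli p).real {ω : Set ι | t ≤ ((F ∪ E).filter (· ∈ ω)).card}) * (prodBernoulli p).real A * (prodBernoulli p).real B =
      (prodBernoulli p).real ({ω : Set ι | t ≤ ((F ∪ E).filter (· ∈ ω)).card} ∩ A) *
          (prodBernoulli p).real ({ω : Set ι | t ≤ ((F ∪ E).filter (· ∈ ω)).card} ∩ B)
        + (1 - (prodBernoulli p).real {ω : Set ι | t ≤ ((F ∪ E).filter (· ∈ ω)).card}) *
          (prodBernoulli p).real ({ω : Set ι | t ≤ ((F ∪ E).filter (· ∈ ω)).card} ∩ A ∩ B)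
        + (prodBernoulli p).real {ω : Set ι | t ≤ ((F ∪ E).filter (· ∈ ω)).card} * (prodBernoulli p).real A * (prodBernoulli p).real B
        - (prodBernoulli p).real ({ω : Set ι | t ≤ ((F ∪ E).filter (· ∈ ω)).card} ∩ A) * (prodBernoulli p).real B
        - (prodBernoulli p).real ({ω : Set ι | t ≤ ((F ∪ E).filter (· ∈ ω)).card} ∩ B) * (prodBernoulli p).real A := by ring
  linarith


/-- **Support form** (memo Theorem 2, remark): slot `Th_t(S)`; `A, B` increasing and determined by a block `D`; density constant `P ∈ (0,1)` on
`D ∩ S` and arbitrary in `(0,1)` on `S ∖ D` (and arbitrary on `D ∖ S` and elsewhere).  Then `0 ≤ n(Th_t(S); A, B)`: the coordinates of `D` outside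
the slot block are removed one at a time by the free-coordinate step `osN_threshold_nonneg_of_sections` (gen 26), then the free-block theorem
applies with `F = D ∩ S`, `E = S ∖ D`. [this work] -/
theorem osN_threshold_nonneg_of_const_on_support (p : ι → unitInterval) {P : ℝ} (hP0 : 0 < P) (hP1 : P < 1) (S D : Finset ι)
    (hpD : ∀ i ∈ D ∩ S, (p i : ℝ) = P) (hpS : ∀ i ∈ S \ D, 0 < (p i : ℝ) ∧ (p i : ℝ) < 1) (t : ℕ) {A B : Set (Set ι)}
    (hA : IsUpperSet A) (hB : IsUpperSet B) (hAD : DeterminedBy A (↑D : Set ι)) (hBD : DeterminedBy B (↑D : Set ι)) :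
    0 ≤ osN p {ω : Set ι | t ≤ (S.filter (· ∈ ω)).card} (ind A) (ind B) := by
  suffices key : ∀ (C : Finset ι), Disjoint C S → ∀ (A B : Set (Set ι)), IsUpperSet A → IsUpperSet B →
      DeterminedBy A (↑((D ∩ S) ∪ C) : Set ι) → DeterminedBy B (↑((D ∩ S) ∪ C) : Set ι) →
      0 ≤ osN p {ω : Set ι | t ≤ (S.filter (· ∈ ω)).card} (ind A) (ind B) by
    have hDS : (D ∩ S) ∪ (D \ S) = D := by
      ext i; simp only [Finset.mem_union, Finset.mem_inter, Finset.mem_sdiff]; tauto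
    exact key (D \ S) Finset.sdiff_disjoint A B hA hB (by rw [hDS]; exact hAD) (by rw [hDS]; exact hBD)
  intro C
  induction C using Finset.induction_on with
  | empty =>
    intro _ A B hA hB hAD hBD
    rw [Finset.union_empty] at hAD hBD
    have hS : (D ∩ S) ∪ (S \ D) = S := by
      ext i; simp only [Finset.mem_union, Finset.mem_inter, Finset.mem_sdiff]; tauto
    have h := osN_threshold_nonneg_of_const_freeBlock p hP0 hP1 (S \ D) hpS (D ∩ S)
      (Finset.disjoint_left.2 fun i hi hi' => (Finset.mem_sdiff.1 hi').2 (Finset.mem_inter.1 hi).1) hpD t hA hB hAD hBD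
    rwa [hS] at h
  | insert c C hcC ih =>
    intro hdisj A B hA hB hAD hBD
    have hcS : c ∉ S := Finset.disjoint_left.1 hdisj (Finset.mem_insert_self c C)
    have hdisj' : Disjoint C S := Finset.disjoint_of_subset_left (Finset.subset_insert c C) hdisj
    have hcoe : (↑((D ∩ S) ∪ insert c C) : Set ι) \ {c} = ↑((D ∩ S) ∪ C) := by
      ext i
      simp only [Set.mem_sdiff, Finset.mem_coe, Finset.mem_union, Finset.mem_inter, Finset.mem_insert, Set.mem_singleton_iff]
      constructor
      · rintro ⟨h | rfl | h, hne⟩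
        · exact Or.inl h
        · exact absurd rfl hne
        · exact Or.inr h
      · rintro (h | h)
        · exact ⟨Or.inl h, fun hic => hcS (hic ▸ h.2)⟩
        · exact ⟨Or.inr (Or.inr h), fun hic => hcC (hic ▸ h)⟩
    refine osN_threshold_nonneg_of_sections p S t hA hB hcS ?_ ?_ ?_ ?_
    · exact ih hdisj' _ _ (isUpperSet_section_insert hA c) (isUpperSet_section_insert hB c)
        (hcoe ▸ determinedBy_section_insert hAD c) (hcoe ▸ determinedBy_section_insert hBD c)
    · exact ih hdisj' _ _ (isUpperSet_section_sdiff hA c) (isUpperSet_section_sdiff hB c)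
        (hcoe ▸ determinedBy_section_sdiff hAD c) (hcoe ▸ determinedBy_section_sdiff hBD c)
    · exact ih hdisj' _ _ (isUpperSet_section_insert hA c) (isUpperSet_section_sdiff hB c)
        (hcoe ▸ determinedBy_section_insert hAD c) (hcoe ▸ determinedBy_section_sdiff hBD c)
    · exact ih hdisj' _ _ (isUpperSet_section_sdiff hA c) (isUpperSet_section_insert hB c)
        (hcoe ▸ determinedBy_section_sdiff hAD c) (hcoe ▸ determinedBy_section_insert hBD c)

/-- **Kahn C5 / Sahi C₃, support form**: slot `Th_t(S)`, `A, B` increasing and `D`-determined, density constant on `D ∩ S`, arbitrary in `(0,1)`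
on `S ∖ D`: `0 ≤ E₃(1_{Th_t(S)}, 1_A, 1_B)`. [this work] -/
theorem sahiE3_threshold_nonneg_of_const_on_support (p : ι → unitInterval) {P : ℝ} (hP0 : 0 < P) (hP1 : P < 1) (S D : Finset ι)
    (hpD : ∀ i ∈ D ∩ S, (p i : ℝ) = P) (hpS : ∀ i ∈ S \ D, 0 < (p i : ℝ) ∧ (p i : ℝ) < 1) (t : ℕ) {A B : Set (Set ι)}
    (hA : IsUpperSet A) (hB : IsUpperSet B) (hAD : DeterminedBy A (↑D : Set ι)) (hBD : DeterminedBy B (↑D : Set ι)) :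
    0 ≤ sahiE3 (prodBernoulli p) {ω : Set ι | t ≤ (S.filter (· ∈ ω)).card} A B := by
  rw [← osT_ind_ind, osT_eq_osMp_add_osN]
  exact add_nonneg (osMp_threshold_nonneg_all p S t hA hB)
    (osN_threshold_nonneg_of_const_on_support p hP0 hP1 S D hpD hpS t hA hB hAD hBD)

end SahiOneStep

end Summit.CriticalPhenomena.PercolationContinuityZ3.Theorems
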